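import Literature.NumberTheory.Automorphic.ConstantTermBlockGL
import Literature.NumberTheory.Automorphic.GLnAdelicIntegrationFacts
import HarnessLib

/-!
# The constant term along a maximal parabolic is left invariant under the rational points of the
# parabolic (Moeglin–Waldspurger 1995, I.2.6; Borel–Jacquet 1979, 4.4)

Topic `NumberTheory/Automorphic`; a sequel of `ConstantTermBlockGL` (the constant term
`φ_P = blockCT (le_refl n) k ν φ`, `φ_P (y) = ∫_D φ ((1 + N) y) dν(N)`, of a function on `GL_n(𝔸_K)`
along the standard maximal parabolic `P_k`, Tate's box `D ⊆ 𝔸_K^{k(n-k)}` in box coordinates).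
Moeglin–Waldspurger I.2.6: "`φ_P` is a function on `N(𝔸) M(k) \ G(𝔸)`", i.e. `φ_P` is left
invariant under `N_k(𝔸_K)` (the tree's `IsLeftInvariant.blockCT_unipotentOfBlock_mul`) and under
the rational points `P_k(K)` of the parabolic. We PROVE the second half:

* `setIntegral_piFundamentalDomain_comp_addEquiv` — **automorphisms of `𝔸_K^ι` preserving the
  lattice `K^ι` do not change box integrals of `K^ι`-periodic continuous functions**:
  `∫_{D^ι} F (T v) dν(v) = ∫_{D^ι} F (v) dν(v)` for an additive Haar measure `ν`, a continuous
  additive automorphism `T` with `T (K^ι) ⊆ K^ι` and `F` continuous and `K^ι`-periodic. Proof by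
  descent to the compact group `𝔸_K^ι ⧸ K^ι` (Tate's Lemma 4.2.1,
  `Literature.Analysis.Fourier.integral_fundamentalDomain_comp_mk`): `T` induces a continuous
  surjective endomorphism of the compact quotient, which preserves its Haar probability measure
  (Mathlib's `AddMonoidHom.measurePreserving` — an automorphism of a compact group has module `1`;
  Weil, *Basic Number Theory*, Ch. I §2). No computation of modules on `𝔸_K^ι` is needed.
* `conj_mem_blockNilpotent`, `blockNilpotentConj`, `boxConj` — conjugation `X ↦ p X p⁻¹` by an
  element `p` of the standard maximal parabolic `P_k` (block upper triangular matrices for the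
  labelling `maximalParabolicLabel n k`) preserves the block `𝔫_k` of strictly upper-right
  block matrices; as an additive automorphism of `𝔫_k(R)` and of its box coordinates
  `R^{BlockIdx n k}`; `unipotentOfBlock_blockNilpotentConj` (`1 + p X p⁻¹ = p (1 + X) p⁻¹`),
  continuity, and preservation of the rational lattice by rational `p`
  (`boxConj_mem_piPrincipalSubgroup`).
* `IsLeftInvariant.blockCT_parabolic_rational_mul` — **`φ_P (γ g) = φ_P (g)` for `γ ∈ P_k(K)`**,
  for `φ` continuous and left `GL_n(K)`-invariant and `ν` an additive Haar measure on the box: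
  `φ ((1 + N) γ g) = φ (γ⁻¹ (1 + N) γ g) = φ ((1 + γ⁻¹ N γ) g)`, and `N ↦ γ⁻¹ N γ` is an automorphism of
  the box preserving the rational lattice.

Everything here is proved; the only definitions are the two conjugation automorphisms.

## References

* C. Moeglin, J.-L. Waldspurger, *Spectral decomposition and Eisenstein series*, Cambridge Tracts
  in Math. 113 (1995), I.2.6 [MoeglinWaldspurger1995].
* A. Borel, H. Jacquet, *Automorphic forms and automorphic representations*, Proc. Sympos. Pure
  Math. 33 (Corvallis 1977), Part 1 (1979), 4.4 [BorelJacquet1979].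
* A. Weil, *Basic Number Theory* (1967), Ch. I §2 (modules of automorphisms) [WeilBNT1967].
* J. Tate, in Cassels–Fröhlich (1967), Ch. XV, Lemma 4.2.1 [CasselsFrohlichANT1967].
-/

noncomputable section

open scoped Matrix
open NumberField IsDedekindDomain Set Filter Function
open _root_.MeasureTheory _root_.MeasureTheory.Measure

namespace Literature.NumberTheory.Automorphic

/-! ### 1. Lattice-preserving automorphisms do not change box integrals of periodic functions -/

section Automorphism

variable {K : Type} [Field K] [NumberField K]
  [MeasurableSpace (AdeleRing (𝓞 K) K)] [BorelSpace (AdeleRing (𝓞 K) K)]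

/-- **Automorphisms of `𝔸_K^ι` preserving `K^ι` do not change box integrals of periodic
functions.** For a finite index type `ι`, an additive Haar measure `ν` on `𝔸_K^ι`, a continuous
additive automorphism `T` of `𝔸_K^ι` with `T (K^ι) ⊆ K^ι`, and `F : 𝔸_K^ι → E` continuous and
`K^ι`-periodic, `∫_{D^ι} F (T v) dν(v) = ∫_{D^ι} F (v) dν(v)`: both sides are `ν(D^ι)` times the
integral of the descent of `F`, resp. `F ∘ T`, to the compact group `𝔸_K^ι ⧸ K^ι` against its Haar
probability measure (Tate's Lemma 4.2.1), and the continuous surjective endomorphism of the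
quotient induced by `T` preserves that measure (`AddMonoidHom.measurePreserving`).
[cite: WeilBNT1967, Ch. I §2] -/
theorem setIntegral_piFundamentalDomain_comp_addEquiv {ι : Type} [Fintype ι]
    (ν : Measure (ι → AdeleRing (𝓞 K) K)) [ν.IsAddHaarMeasure]
    (T : (ι → AdeleRing (𝓞 K) K) ≃+ (ι → AdeleRing (𝓞 K) K)) (hTc : Continuous T)
    (hT : ∀ γ ∈ piPrincipalSubgroup K ι, T γ ∈ piPrincipalSubgroup K ι)
    {E : Type*} [NormedAddCommGroup E] [NormedSpace ℝ E]
    {F : (ι → AdeleRing (𝓞 K) K) → E} (hFc : Continuous F)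
    (hF : ∀ (v : ι → AdeleRing (𝓞 K) K) (ξ : ι → K),
      F (v + fun i => algebraMap K (AdeleRing (𝓞 K) K) (ξ i)) = F v) :
    ∫ v in piFundamentalDomain K ι, F (T v) ∂ν = ∫ v in piFundamentalDomain K ι, F v ∂ν := by
  haveI := locallyCompactSpace_adeleRing' K
  haveI := secondCountableTopology_adeleRing K
  haveI := t2Space_adeleRing K
  haveI : Countable K := NumberField.countable' (K := K)
  haveI : BorelSpace (ι → AdeleRing (𝓞 K) K) := Pi.borelSpace
  letI : MeasurableSpace ((ι → AdeleRing (𝓞 K) K) ⧸ piPrincipalSubgroup K ι) := borel _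
  haveI : BorelSpace ((ι → AdeleRing (𝓞 K) K) ⧸ piPrincipalSubgroup K ι) := ⟨rfl⟩
  have hfin : ν (piFundamentalDomain K ι) ≠ ⊤ :=
    ((measure_mono subset_closure).trans_lt (isCompact_closure_piFundamentalDomain K ι).measure_lt_top).ne
  -- periodicity under the subgroup and the descent of `F`
  have hF' : ∀ (v : ι → AdeleRing (𝓞 K) K) (γ : piPrincipalSubgroup K ι), F (v + γ) = F v := by
    intro v γ
    obtain ⟨ξ, hξ⟩ := (piPrincipalSubgroupEquiv K ι).surjective γ
    have : (γ : ι → AdeleRing (𝓞 K) K) = fun i => algebraMap K (AdeleRing (𝓞 K) K) (ξ i) := by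
      rw [← hξ, coe_piPrincipalSubgroupEquiv]
    rw [this]; exact hF v ξ
  let G : (ι → AdeleRing (𝓞 K) K) ⧸ piPrincipalSubgroup K ι → E :=
    Quotient.lift (s := QuotientAddGroup.leftRel (piPrincipalSubgroup K ι)) F fun a b hab => by
      have h : -a + b ∈ piPrincipalSubgroup K ι := QuotientAddGroup.leftRel_apply.1 hab
      have h' : F (a + (-a + b)) = F a := hF' a ⟨-a + b, h⟩
      rw [add_neg_cancel_left] at h'
      exact h'.symm
  have hGmk : ∀ v, G (QuotientAddGroup.mk v) = F v := fun v => rfl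
  have hGc : Continuous G := by
    rw [(QuotientAddGroup.isQuotientMap_mk (piPrincipalSubgroup K ι)).continuous_iff]; exact hFc
  set μQ : Measure ((ι → AdeleRing (𝓞 K) K) ⧸ piPrincipalSubgroup K ι) := Measure.addHaarMeasure ⊤
    with hμQ
  -- the endomorphism of the quotient induced by `T`
  set Tbar : (ι → AdeleRing (𝓞 K) K) ⧸ piPrincipalSubgroup K ι →+
      (ι → AdeleRing (𝓞 K) K) ⧸ piPrincipalSubgroup K ι :=
    QuotientAddGroup.map (piPrincipalSubgroup K ι) (piPrincipalSubgroup K ι) T.toAddMonoidHom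
      (fun γ hγ => hT γ hγ) with hTbar
  have hTbar_mk : ∀ v, Tbar (QuotientAddGroup.mk v) = QuotientAddGroup.mk (T v) := fun v => rfl
  have hTbar_cont : Continuous Tbar := by
    rw [(QuotientAddGroup.isQuotientMap_mk (piPrincipalSubgroup K ι)).continuous_iff]
    exact continuous_quot_mk.comp hTc
  have hTbar_surj : Surjective Tbar := by
    intro q
    obtain ⟨v, rfl⟩ := QuotientAddGroup.mk_surjective q
    exact ⟨QuotientAddGroup.mk (T.symm v), by rw [hTbar_mk, AddEquiv.apply_symm_apply]⟩
  have hmp : MeasurePreserving Tbar μQ μQ :=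
    AddMonoidHom.measurePreserving hTbar_cont hTbar_surj rfl
  have h1 : ∫ v in piFundamentalDomain K ι, F (T v) ∂ν =
      (ν (piFundamentalDomain K ι)).toReal • ∫ q, G (Tbar q) ∂μQ := by
    have := Literature.Analysis.Fourier.integral_fundamentalDomain_comp_mk ν (isClosed_piPrincipalSubgroup K ι)
      (isAddFundamentalDomain_op_piFundamentalDomain K ι ν) hfin (G := fun q => G (Tbar q))
      ((hGc.comp hTbar_cont).aestronglyMeasurable)
    refine Eq.trans (setIntegral_congr_fun (measurableSet_piFundamentalDomain K ι) fun v _ => ?_) this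
    change F (T v) = G (Tbar (QuotientAddGroup.mk v))
    rw [hTbar_mk, hGmk]
  have h2 : ∫ q, G (Tbar q) ∂μQ = ∫ q, G q ∂μQ := by
    have := integral_map (μ := μQ) hTbar_cont.measurable.aemeasurable
      (hGc.aestronglyMeasurable (μ := μQ.map _))
    rw [hmp.map_eq] at this
    exact this.symm
  have h3 : ∫ v in piFundamentalDomain K ι, F v ∂ν = (ν (piFundamentalDomain K ι)).toReal • ∫ q, G q ∂μQ :=
    Literature.Analysis.Fourier.integral_fundamentalDomain_comp_mk ν (isClosed_piPrincipalSubgroup K ι)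
      (isAddFundamentalDomain_op_piFundamentalDomain K ι ν) hfin (G := G) hGc.aestronglyMeasurable
  rw [h1, h2, ← h3]

end Automorphism

/-! ### 2. Conjugation by the parabolic on `𝔫_k` and on its box coordinates -/

section Conj

variable {R : Type*} [CommRing R] {n k : ℕ}

/-- Indices `< k` have label `0` for the maximal parabolic `P_k`. [folklore] -/
theorem maximalParabolicLabel_of_lt {i : Fin n} (hi : (i : ℕ) < k) : maximalParabolicLabel n k i = 0 := by
  unfold maximalParabolicLabel
  rw [if_pos hi]

/-- Indices `≥ k` have label `1` for the maximal parabolic `P_k`. [folklore] -/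
theorem maximalParabolicLabel_of_le {i : Fin n} (hi : k ≤ (i : ℕ)) : maximalParabolicLabel n k i = 1 := by
  unfold maximalParabolicLabel
  rw [if_neg (not_lt.2 hi)]

/-- A lower-left entry of an element of `P_k` vanishes: `p i a = 0` if `a < k ≤ i`. [folklore] -/
theorem apply_eq_zero_of_mem_standardParabolicGL {p : GL (Fin n) R}
    (hp : p ∈ standardParabolicGL R (maximalParabolicLabel n k)) {i a : Fin n}
    (hi : k ≤ (i : ℕ)) (ha : (a : ℕ) < k) : (p : Matrix (Fin n) (Fin n) R) i a = 0 := by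
  have hlt : maximalParabolicLabel n k a < maximalParabolicLabel n k i := by
    rw [maximalParabolicLabel_of_lt ha, maximalParabolicLabel_of_le hi]
    exact Fin.zero_lt_one
  exact hp hlt

/-- **Conjugation by `P_k` preserves `𝔫_k`**: for `p` block upper triangular (labelling
`maximalParabolicLabel n k`) and `X` supported in the block `i < k ≤ j`, so is `p X p⁻¹`
(`(p X p⁻¹)_{ij} = ∑ p_{ia} X_{ac} (p⁻¹)_{cj}` with `a < k ≤ c`, and `p_{ia} = 0` for `i ≥ k`,
`(p⁻¹)_{cj} = 0` for `j < k`). [folklore] -/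
theorem conj_mem_blockNilpotent {p : GL (Fin n) R}
    (hp : p ∈ standardParabolicGL R (maximalParabolicLabel n k)) {X : Matrix (Fin n) (Fin n) R}
    (hX : X ∈ blockNilpotent n k R) :
    (p : Matrix (Fin n) (Fin n) R) * X * ((p⁻¹ : GL (Fin n) R) : Matrix (Fin n) (Fin n) R) ∈
      blockNilpotent n k R := by
  have hp' : p⁻¹ ∈ standardParabolicGL R (maximalParabolicLabel n k) := inv_mem hp
  intro i j hij
  by_contra hcon
  apply hij
  rw [Matrix.mul_apply]
  refine Finset.sum_eq_zero fun c _ => ?_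
  rw [Matrix.mul_apply, Finset.sum_mul]
  refine Finset.sum_eq_zero fun a _ => ?_
  by_cases hXac : X a c = 0
  · rw [hXac, mul_zero, zero_mul]
  obtain ⟨ha, hc⟩ := hX a c hXac
  rcases not_and_or.mp hcon with hi | hj
  · rw [apply_eq_zero_of_mem_standardParabolicGL hp (not_lt.1 hi) ha, zero_mul, zero_mul]
  · rw [apply_eq_zero_of_mem_standardParabolicGL hp' hc (not_le.1 hj), mul_zero]

/-- **Conjugation `X ↦ p X p⁻¹` by `p ∈ P_k` as an additive automorphism of `𝔫_k(R)`** (inverse: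
conjugation by `p⁻¹`). [folklore] -/
def blockNilpotentConj (p : standardParabolicGL R (maximalParabolicLabel n k)) :
    blockNilpotent n k R ≃+ blockNilpotent n k R where
  toFun X := ⟨((p : GL (Fin n) R) : Matrix (Fin n) (Fin n) R) * X *
      (((p : GL (Fin n) R)⁻¹ : GL (Fin n) R) : Matrix (Fin n) (Fin n) R),
    conj_mem_blockNilpotent p.2 X.2⟩
  invFun X := ⟨(((p : GL (Fin n) R)⁻¹ : GL (Fin n) R) : Matrix (Fin n) (Fin n) R) * X *
      ((p : GL (Fin n) R) : Matrix (Fin n) (Fin n) R), by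
    have h := conj_mem_blockNilpotent (inv_mem p.2 : (p : GL (Fin n) R)⁻¹ ∈ _) X.2
    rwa [inv_inv] at h⟩
  left_inv X := by
    refine Subtype.ext ?_
    change (((p : GL (Fin n) R)⁻¹ : GL (Fin n) R) : Matrix (Fin n) (Fin n) R) *
      (((p : GL (Fin n) R) : Matrix (Fin n) (Fin n) R) * X *
        (((p : GL (Fin n) R)⁻¹ : GL (Fin n) R) : Matrix (Fin n) (Fin n) R)) *
      ((p : GL (Fin n) R) : Matrix (Fin n) (Fin n) R) = X
    rw [← mul_assoc, ← mul_assoc, ← Units.val_mul, inv_mul_cancel, Units.val_one, one_mul,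
      mul_assoc, ← Units.val_mul, inv_mul_cancel, Units.val_one, mul_one]
  right_inv X := by
    refine Subtype.ext ?_
    change ((p : GL (Fin n) R) : Matrix (Fin n) (Fin n) R) *
      ((((p : GL (Fin n) R)⁻¹ : GL (Fin n) R) : Matrix (Fin n) (Fin n) R) * X *
        ((p : GL (Fin n) R) : Matrix (Fin n) (Fin n) R)) *
      (((p : GL (Fin n) R)⁻¹ : GL (Fin n) R) : Matrix (Fin n) (Fin n) R) = X
    rw [← mul_assoc, ← mul_assoc, ← Units.val_mul, mul_inv_cancel, Units.val_one, one_mul,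
      mul_assoc, ← Units.val_mul, mul_inv_cancel, Units.val_one, mul_one]
  map_add' X Y := by
    refine Subtype.ext ?_
    change ((p : GL (Fin n) R) : Matrix (Fin n) (Fin n) R) * ((X : Matrix (Fin n) (Fin n) R) + Y) *
      (((p : GL (Fin n) R)⁻¹ : GL (Fin n) R) : Matrix (Fin n) (Fin n) R) = _
    rw [mul_add, add_mul]
    rfl

/-- The matrix of `blockNilpotentConj p X` is `p X p⁻¹`. [folklore] -/
@[simp]
theorem coe_blockNilpotentConj (p : standardParabolicGL R (maximalParabolicLabel n k))
    (X : blockNilpotent n k R) :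
    ((blockNilpotentConj p X : blockNilpotent n k R) : Matrix (Fin n) (Fin n) R) =
      ((p : GL (Fin n) R) : Matrix (Fin n) (Fin n) R) * X *
        (((p : GL (Fin n) R)⁻¹ : GL (Fin n) R) : Matrix (Fin n) (Fin n) R) :=
  rfl

/-- **`1 + p X p⁻¹ = p (1 + X) p⁻¹`**: conjugation on `𝔫_k` is conjugation on the unipotent radical
`N_k = 1 + 𝔫_k`. [folklore] -/
theorem unipotentOfBlock_blockNilpotentConj (p : standardParabolicGL R (maximalParabolicLabel n k))
    (X : blockNilpotent n k R) :
    unipotentOfBlock n k R (Multiplicative.ofAdd (blockNilpotentConj p X)) =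
      (p : GL (Fin n) R) * unipotentOfBlock n k R (Multiplicative.ofAdd X) * (p : GL (Fin n) R)⁻¹ := by
  refine Units.ext ?_
  rw [Units.val_mul, Units.val_mul, coe_unipotentOfBlock, coe_unipotentOfBlock]
  change (1 : Matrix (Fin n) (Fin n) R) + (((p : GL (Fin n) R) : Matrix (Fin n) (Fin n) R) * X *
      (((p : GL (Fin n) R)⁻¹ : GL (Fin n) R) : Matrix (Fin n) (Fin n) R)) =
    ((p : GL (Fin n) R) : Matrix (Fin n) (Fin n) R) * (1 + (X : Matrix (Fin n) (Fin n) R)) *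
      (((p : GL (Fin n) R)⁻¹ : GL (Fin n) R) : Matrix (Fin n) (Fin n) R)
  rw [mul_add, add_mul, mul_one, ← Units.val_mul, mul_inv_cancel, Units.val_one]

variable (R) in
/-- **Conjugation by `p ∈ P_k` in box coordinates**: the additive automorphism of `R^{BlockIdx n k}`
corresponding to `X ↦ p X p⁻¹` under `blockMatrixEquiv`. [folklore] -/
def boxConj (p : standardParabolicGL R (maximalParabolicLabel n k)) :
    (BlockIdx n k → R) ≃+ (BlockIdx n k → R) :=
  (blockMatrixEquiv R n k).trans ((blockNilpotentConj p).trans (blockMatrixEquiv R n k).symm)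

/-- `blockMatrixEquiv (boxConj p N) = p (blockMatrixEquiv N) p⁻¹`. [folklore] -/
theorem blockMatrixEquiv_boxConj (p : standardParabolicGL R (maximalParabolicLabel n k))
    (N : BlockIdx n k → R) :
    blockMatrixEquiv R n k (boxConj R p N) = blockNilpotentConj p (blockMatrixEquiv R n k N) := by
  simp only [boxConj, AddEquiv.trans_apply, AddEquiv.apply_symm_apply]

/-- In box coordinates: `1 + (boxConj p N) = p (1 + N) p⁻¹`. [folklore] -/
theorem unipotentOfBlock_boxConj (p : standardParabolicGL R (maximalParabolicLabel n k))
    (N : BlockIdx n k → R) :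
    unipotentOfBlock n k R (Multiplicative.ofAdd (blockMatrixEquiv R n k (boxConj R p N))) =
      (p : GL (Fin n) R) * unipotentOfBlock n k R (Multiplicative.ofAdd (blockMatrixEquiv R n k N)) *
        (p : GL (Fin n) R)⁻¹ := by
  rw [blockMatrixEquiv_boxConj, unipotentOfBlock_blockNilpotentConj]

/-- `boxConj` is continuous over a topological ring. [folklore] -/
theorem continuous_boxConj [TopologicalSpace R] [IsTopologicalRing R]
    (p : standardParabolicGL R (maximalParabolicLabel n k)) : Continuous (boxConj R p) := by
  have h : Continuous (blockNilpotentConj p : blockNilpotent n k R → blockNilpotent n k R) :=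
    Continuous.subtype_mk ((continuous_const.mul continuous_subtype_val).mul continuous_const) _
  exact (continuous_blockMatrixEquiv_symm n k).comp (h.comp (continuous_blockMatrixEquiv n k))

end Conj

/-! ### 3. Rational parabolic elements and the invariance of the constant term -/

section Rational

variable {K : Type} [Field K] [NumberField K] {n k : ℕ}

/-- A rational block upper triangular matrix is block upper triangular over the adeles (the case
`f = algebraMap K 𝔸_K` of `map_mem_standardParabolicGL` of `ParabolicGLBigCell`, which is not
imported here). [folklore] -/
private theorem map_algebraMap_mem_standardParabolicGL {γ : GL (Fin n) K}
    (hγ : γ ∈ standardParabolicGL K (maximalParabolicLabel n k)) :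
    Matrix.GeneralLinearGroup.map (algebraMap K (AdeleRing (𝓞 K) K)) γ ∈
      standardParabolicGL (AdeleRing (𝓞 K) K) (maximalParabolicLabel n k) := by
  change (((γ : Matrix (Fin n) (Fin n) K).map (algebraMap K (AdeleRing (𝓞 K) K)))).BlockTriangular
    (maximalParabolicLabel n k)
  exact Matrix.BlockTriangular.map _ hγ

/-- The entries of the adelic image of a rational matrix are principal adeles. [folklore] -/
theorem map_apply_mem_range (γ : GL (Fin n) K) (i j : Fin n) :
    ((Matrix.GeneralLinearGroup.map (algebraMap K (AdeleRing (𝓞 K) K)) γ : GL (Fin n) (AdeleRing (𝓞 K) K)) :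
      Matrix (Fin n) (Fin n) (AdeleRing (𝓞 K) K)) i j ∈ (algebraMap K (AdeleRing (𝓞 K) K)).range :=
  ⟨(γ : Matrix (Fin n) (Fin n) K) i j, rfl⟩

/-- **Rational parabolic elements preserve the rational lattice of the box**: if `p ∈ P_k(𝔸_K)` is
the adelic image of a rational matrix `γ`, then `boxConj p` maps `K^{BlockIdx}` into itself (the
entries of `γ X γ⁻¹` are sums of products of principal adeles). [folklore] -/
theorem boxConj_mem_piPrincipalSubgroup
    {p : standardParabolicGL (AdeleRing (𝓞 K) K) (maximalParabolicLabel n k)} {γ : GL (Fin n) K}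
    (hp : (p : GL (Fin n) (AdeleRing (𝓞 K) K)) = Matrix.GeneralLinearGroup.map (algebraMap K (AdeleRing (𝓞 K) K)) γ)
    {N : BlockIdx n k → AdeleRing (𝓞 K) K} (hN : N ∈ piPrincipalSubgroup K (BlockIdx n k)) :
    boxConj (AdeleRing (𝓞 K) K) p N ∈ piPrincipalSubgroup K (BlockIdx n k) := by
  rw [← blockMatrixEquiv_mem_rationalBlock_iff] at hN ⊢
  rw [blockMatrixEquiv_boxConj, mem_rationalBlock_iff]
  intro i j
  rw [coe_blockNilpotentConj, hp]
  have hpinv : (Matrix.GeneralLinearGroup.map (algebraMap K (AdeleRing (𝓞 K) K)) γ)⁻¹ =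
      Matrix.GeneralLinearGroup.map (algebraMap K (AdeleRing (𝓞 K) K)) γ⁻¹ := by
    rw [map_inv]
  rw [hpinv, Matrix.mul_apply]
  refine Subring.sum_mem _ fun c _ => Subring.mul_mem _ ?_ (map_apply_mem_range γ⁻¹ c j)
  rw [Matrix.mul_apply]
  exact Subring.sum_mem _ fun a _ => Subring.mul_mem _ (map_apply_mem_range γ i a) (hN a c)

variable [MeasurableSpace (AdeleRing (𝓞 K) K)] [BorelSpace (AdeleRing (𝓞 K) K)]

/-- **The constant term along `P_k` is left invariant under `P_k(K)`** (Moeglin–Waldspurger 1995,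
I.2.6: `φ_P` is a function on `N(𝔸) M(k) \ G(𝔸)`; with `IsLeftInvariant.blockCT_unipotentOfBlock_mul`
for `N_k(𝔸_K)`). For `φ` continuous and left `GL_n(K)`-invariant, an additive Haar measure `ν` on the
box coordinates of `𝔫_k(𝔸_K)`, `γ ∈ P_k(K)` and `g ∈ GL_n(𝔸_K)`, `φ_P (γ g) = φ_P (g)`: writing
`(1 + N) γ = γ (1 + γ⁻¹ N γ)` and using the left invariance of `φ` under `γ`,
`φ_P (γ g) = ∫_D φ ((1 + γ⁻¹ N γ) g) dν(N)`, and the automorphism `N ↦ γ⁻¹ N γ` of the box preserves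
the rational lattice, hence box integrals of the periodic function `N ↦ φ ((1 + N) g)`
(`setIntegral_piFundamentalDomain_comp_addEquiv`). [cite: MoeglinWaldspurger1995, I.2.6] -/
theorem IsLeftInvariant.blockCT_parabolic_rational_mul {φ : GL (Fin n) (AdeleRing (𝓞 K) K) → ℂ}
    (hφc : Continuous φ) (hφ : IsLeftInvariant (AdelicGroupData.gl n K) φ)
    (ν : Measure (BlockIdx n k → AdeleRing (𝓞 K) K)) [ν.IsAddHaarMeasure]
    {γ : GL (Fin n) K} (hγ : γ ∈ standardParabolicGL K (maximalParabolicLabel n k))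
    (g : GL (Fin n) (AdeleRing (𝓞 K) K)) :
    blockCT (le_refl n) k ν φ (Matrix.GeneralLinearGroup.map (algebraMap K (AdeleRing (𝓞 K) K)) γ * g) =
      blockCT (le_refl n) k ν φ g := by
  haveI := t2Space_adeleRing K
  haveI := secondCountableTopology_adeleRing K
  haveI : BorelSpace (BlockIdx n k → AdeleRing (𝓞 K) K) := Pi.borelSpace
  -- the rational parabolic element, over the adeles, and the conjugation by its inverse
  set p : GL (Fin n) (AdeleRing (𝓞 K) K) := Matrix.GeneralLinearGroup.map (algebraMap K (AdeleRing (𝓞 K) K)) γ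
    with hp
  have hγ' : γ⁻¹ ∈ standardParabolicGL K (maximalParabolicLabel n k) := inv_mem hγ
  set q : standardParabolicGL (AdeleRing (𝓞 K) K) (maximalParabolicLabel n k) :=
    ⟨_, map_algebraMap_mem_standardParabolicGL hγ'⟩ with hq
  have hqp : (q : GL (Fin n) (AdeleRing (𝓞 K) K)) = p⁻¹ := by
    rw [hq, hp, ← map_inv]
  have hpK : p ∈ (AdelicGroupData.gl n K).arithmeticSubgroup := ⟨γ, rfl⟩
  set T : (BlockIdx n k → AdeleRing (𝓞 K) K) ≃+ (BlockIdx n k → AdeleRing (𝓞 K) K) :=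
    boxConj (AdeleRing (𝓞 K) K) q with hT
  -- `(1 + N) γ g = γ ((1 + γ⁻¹ N γ) g)`
  have hconj : ∀ N : BlockIdx n k → AdeleRing (𝓞 K) K,
      unipotentOfBlock n k (AdeleRing (𝓞 K) K)
          (Multiplicative.ofAdd (blockMatrixEquiv (AdeleRing (𝓞 K) K) n k N)) * (p * g) =
        p * (unipotentOfBlock n k (AdeleRing (𝓞 K) K)
          (Multiplicative.ofAdd (blockMatrixEquiv (AdeleRing (𝓞 K) K) n k (T N))) * g) := by
    intro N
    rw [hT, unipotentOfBlock_boxConj, hqp, inv_inv]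
    simp only [mul_assoc, mul_inv_cancel_left]
  have hinv : ∀ N : BlockIdx n k → AdeleRing (𝓞 K) K,
      φ (p * (unipotentOfBlock n k (AdeleRing (𝓞 K) K)
          (Multiplicative.ofAdd (blockMatrixEquiv (AdeleRing (𝓞 K) K) n k (T N))) * g)) =
        φ (unipotentOfBlock n k (AdeleRing (𝓞 K) K)
          (Multiplicative.ofAdd (blockMatrixEquiv (AdeleRing (𝓞 K) K) n k (T N))) * g) :=
    fun N => hφ p hpK _
  rw [blockCT_apply, blockCT_apply]
  simp_rw [glCorner_refl, hconj, hinv]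
  -- the automorphism `T` preserves the lattice: apply §1 to the periodic integrand
  exact setIntegral_piFundamentalDomain_comp_addEquiv ν T (continuous_boxConj q)
    (fun N hN => boxConj_mem_piPrincipalSubgroup (p := q) (γ := γ⁻¹) rfl hN)
    (continuous_apply_unipotentOfBlock_blockMatrixEquiv hφc g)
    (fun N ξ => hφ.apply_unipotentOfBlock_blockMatrixEquiv_add N ξ g)

end Rational

end Literature.NumberTheory.Automorphic
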